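import Summits.HubbardSuperconductivity.HubbardSuperconductivity.Theorems.AposterioriCapRgDefs
import Literature.MathematicalPhysics.QuantumLattice.XYOrderRiemannSumProofs
import Literature.MathematicalPhysics.QuantumLattice.LatticeToriProofs

/-!
# `XYOrderOpennessLargeSpin`, line `feynman-sector-gap`: the infrared disc sum (`stub_discSum`)

Crux item stmt-HubbardSuperconductivity-13895 (route `AposterioriCapRg`), vocabulary of
`Theorems/AposterioriCapRgDefs.lean`. Pure lattice analysis on the dual torus `(ℤ/Lℤ)²` — the
finite-volume form of the `d = 2`, `T = 0` signature `∫ d²p/|p| < ∞` of Kennedy–Lieb–Shastry's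
infrared bookkeeping (PRL 61 (1988) 2582, after eq. (8)):

`Σ_{q ≠ 0, disp(p_q) ≤ η} disp(p_q)^{-1/2} ≤ K₁ √η L²`, with `K₁ = 6`, for every side `L ≥ 1`,

where `p_q = latticeMomentum L q = 2πq/L` and `disp(p) = Σᵢ (1 - cos pᵢ)` (`TorusFourier.lean`).

Proof. Let `N(q) = dist(q, 0) = maxᵢ min (qᵢ.val, L - qᵢ.val)` be the periodic sup-norm of `q`
(`torusDist`/`torusNorm` of `LatticeTori.lean`). Jordan's inequality `1 - cos x ≥ (2/π²) x²` on
`[-π, π]` (Mathlib `Real.cos_le_one_sub_mul_cos_sq`), applied to the signed representative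
`valMinAbs qᵢ ∈ (-L/2, L/2]` (`cos_two_pi_val_div`, `valMinAbs_bounds` of
`XYOrderIntegralProofs.lean`), gives `1 - cos p_{q,i} ≥ 8 mᵢ²/L²` with
`mᵢ = |valMinAbs qᵢ| = min (qᵢ.val, L - qᵢ.val)`; hence `disp(p_q) ≥ 8 N(q)²/L² ≥ (2N(q)/L)²`.
So on the disc `N(q) ≤ √η L`, for `q ≠ 0` one has `N(q) ≥ 1`, and `disp^{-1/2} ≤ L/(2N(q))`.
Radial summation against the sphere count `#{dist(·, 0) = r} ≤ 4(2r+1) ≤ 12 r`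
(`sum_radial_le`, `card_filter_torusDist_eq_le` of `LatticeToriProofs.lean`) bounds the sum by
`Σ_{1 ≤ r ≤ √η L} 12 r · L/(2r) ≤ 6 √η L²`.
-/

noncomputable section

namespace Summit.HubbardSuperconductivity.HubbardSuperconductivity.Theorems.XYOrderOpennessLargeSpin

set_option linter.dupNamespace false -- summit = problem name (single-conjunct summit), D-0017

open Matrix Complex Finset
open scoped ComplexOrder
open Literature.MathematicalPhysics.QuantumLattice Literature.Probability.LatticeModels

/-! ### One coordinate: Jordan's inequality on the dual torus -/

/-- `8 m²/L² ≤ 1 - cos pᵢ` for the cyclic absolute value `m = min (qᵢ.val, L - qᵢ.val)` of the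
coordinate `qᵢ` of a dual-torus point (Jordan's inequality `cos x ≤ 1 - (2/π²) x²` on `[-π, π]`
for the signed representative `valMinAbs qᵢ ∈ (-L/2, L/2]`, `|valMinAbs qᵢ| = m`). [folklore] -/
private theorem sq_cyclicAbs_le_one_sub_cos {L : ℕ} [NeZero L] (q : TorusSite 2 L) (i : Fin 2) :
    8 * ((min (q i).val (L - (q i).val) : ℕ) : ℝ) ^ 2 / (L : ℝ) ^ 2 ≤
      1 - Real.cos (latticeMomentum L q i) := by
  have hL : (0 : ℝ) < L := by exact_mod_cast Nat.pos_of_ne_zero (NeZero.ne L)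
  set m : ℝ := ((q i).valMinAbs : ℝ) with hm_def
  have hcast : ((min (q i).val (L - (q i).val) : ℕ) : ℝ) ^ 2 = m ^ 2 := by
    rw [← ZMod.valMinAbs_natAbs_eq_min, Nat.cast_natAbs, Int.cast_abs, _root_.sq_abs]
  rw [hcast, latticeMomentum_apply, cos_two_pi_val_div]
  have habs : |2 * Real.pi / L * m| ≤ Real.pi := by
    obtain ⟨h1, h2⟩ := valMinAbs_bounds L (q i)
    have hh : 0 < 2 * Real.pi / L := by positivity
    rw [_root_.abs_le]
    constructor
    · have h3 : 2 * Real.pi / L * (-(L : ℝ) / 2) = -Real.pi := by field_simp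
      have h4 := mul_le_mul_of_nonneg_left (show -(L : ℝ) / 2 ≤ m by linarith) hh.le
      rwa [h3] at h4
    · have h3 : 2 * Real.pi / L * ((L : ℝ) / 2) = Real.pi := by field_simp
      have h4 := mul_le_mul_of_nonneg_left (show m ≤ (L : ℝ) / 2 by linarith) hh.le
      rwa [h3] at h4
  have h1 := Real.cos_le_one_sub_mul_cos_sq habs
  have hx2 : 2 / Real.pi ^ 2 * (2 * Real.pi / L * m) ^ 2 = 8 * m ^ 2 / (L : ℝ) ^ 2 := by
    field_simp
    ring
  linarith

/-! ### The periodic sup-norm controls the dispersion from below -/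

/-- `8 N(q)²/L² ≤ disp(p_q)` with `N(q) = dist(q, 0)` the periodic sup-norm of `q` (take the
coordinate realising the maximum and drop the other, nonnegative, term of the dispersion).
[folklore] -/
private theorem sq_torusDist_le_dispersion {L : ℕ} [NeZero L] (q : TorusSite 2 L) :
    8 * ((torusDist q 0 : ℕ) : ℝ) ^ 2 / (L : ℝ) ^ 2 ≤ dispersion (latticeMomentum L q) := by
  obtain ⟨i, -, hi⟩ := exists_mem_eq_sup (univ : Finset (Fin 2)) univ_nonempty
    (fun j => min (q j).val (L - (q j).val))
  have hdist : torusDist q 0 = min (q i).val (L - (q i).val) := by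
    unfold torusDist
    rw [sub_zero]
    simpa only [torusNorm] using hi
  rw [hdist]
  calc _ ≤ 1 - Real.cos (latticeMomentum L q i) := sq_cyclicAbs_le_one_sub_cos q i
    _ ≤ dispersion (latticeMomentum L q) := by
        unfold dispersion
        exact single_le_sum (f := fun j => 1 - Real.cos (latticeMomentum L q j))
          (fun j _ => sub_nonneg.2 (Real.cos_le_one _)) (mem_univ i)

/-- A nonzero point of the torus `(ℤ/Lℤ)²` is at periodic sup-distance `≥ 1` from the origin
(a nonzero coordinate has representative in `{1, …, L - 1}`). [folklore] -/
private theorem one_le_torusDist {L : ℕ} [NeZero L] {q : TorusSite 2 L} (hq : q ≠ 0) :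
    1 ≤ torusDist q 0 := by
  obtain ⟨i, hi⟩ := Function.ne_iff.1 hq
  have hval : (q i).val ≠ 0 := (ZMod.val_ne_zero (q i)).2 hi
  have hlt := ZMod.val_lt (q i)
  have h1 : 1 ≤ min (q i).val (L - (q i).val) := by omega
  unfold torusDist
  rw [sub_zero]
  simp only [torusNorm]
  exact h1.trans (le_sup (f := fun j => min (q j).val (L - (q j).val)) (mem_univ i))

/-! ### The disc sum -/

/-- **Infrared disc sum on the dual torus `(ℤ/Lℤ)²`** (registered stub `stub_discSum` of the line
`feynman-sector-gap`): there is `K₁ > 0` (here `K₁ = 6`) such that for every `η > 0`, eventually in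
`L` (here: for every `L ≥ 1`), `Σ_{q ≠ 0, disp(p_q) ≤ η} disp(p_q)^{-1/2} ≤ K₁ √η L²` — the
finite-volume `d = 2`, `T = 0` signature `∫_{|p| ≲ √η} d²p/|p| ∝ √η`. Proof: with
`N(q) = dist(q, 0)` the periodic sup-norm, `disp(p_q) ≥ 8N(q)²/L²` (Jordan), so on the punctured
disc `1 ≤ N(q) ≤ √η L` and `disp^{-1/2} ≤ L/(2N(q))`; radial summation against the sphere count
`#{dist = r} ≤ 4(2r + 1) ≤ 12 r` gives `≤ Σ_{1 ≤ r ≤ √η L} 6L ≤ 6 √η L²`.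
[Kennedy–Lieb–Shastry 1988, after eq. (8): the `|p|⁻¹` singularity is integrable in `d ≥ 2`]
[folklore] -/
theorem stub_discSum :
    ∃ K₁ : ℝ, 0 < K₁ ∧ ∀ η : ℝ, 0 < η → ∃ L₁ : ℕ, ∀ (L : ℕ) [NeZero L], L₁ ≤ L →
      ∑ q ∈ ((univ : Finset (TorusSite 2 L)).erase 0).filter
          (fun q => dispersion (latticeMomentum L q) ≤ η),
        (Real.sqrt (dispersion (latticeMomentum L q)))⁻¹ ≤ K₁ * Real.sqrt η * (L : ℝ) ^ 2 := by
  refine ⟨6, by norm_num, fun η hη => ⟨0, ?_⟩⟩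
  intro L _ _
  have hL : (0 : ℝ) < L := by exact_mod_cast Nat.pos_of_ne_zero (NeZero.ne L)
  -- the radius `√η L` of the disc in lattice units, rounded down
  obtain ⟨Rn, hRn, hleRn⟩ : ∃ Rn : ℕ, (Rn : ℝ) ≤ Real.sqrt η * L ∧
      ∀ N : ℕ, (N : ℝ) ≤ Real.sqrt η * L → N ≤ Rn :=
    ⟨⌊Real.sqrt η * L⌋₊, Nat.floor_le (by positivity), fun N h => Nat.le_floor h⟩
  -- the radial majorant
  set F : ℕ → ℝ := fun r => if 1 ≤ r ∧ r ≤ Rn then (L : ℝ) / (2 * r) else 0 with hF_def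
  have hF0 : ∀ r, 0 ≤ F r := fun r => by
    simp only [hF_def]
    split_ifs
    · positivity
    · exact le_rfl
  -- (1) pointwise on the punctured disc: `disp(p_q)^{-1/2} ≤ F (dist(q, 0))`
  have hpt : ∀ q ∈ ((univ : Finset (TorusSite 2 L)).erase 0).filter
      (fun q => dispersion (latticeMomentum L q) ≤ η),
      (Real.sqrt (dispersion (latticeMomentum L q)))⁻¹ ≤ F (torusDist q 0) := by
    intro q hq
    rw [mem_filter, mem_erase] at hq
    obtain ⟨⟨hq0, -⟩, hqη⟩ := hq
    have h1 := one_le_torusDist hq0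
    have h2 := sq_torusDist_le_dispersion q
    generalize torusDist q 0 = N at h1 h2 ⊢
    have hN1 : (1 : ℝ) ≤ N := by exact_mod_cast h1
    have hN0 : (0 : ℝ) < N := by linarith
    have hNR : N ≤ Rn := by
      refine hleRn N ?_
      have h3 : 8 * (N : ℝ) ^ 2 / (L : ℝ) ^ 2 ≤ η := h2.trans hqη
      rw [div_le_iff₀ (by positivity)] at h3
      have h4 : (N : ℝ) ^ 2 ≤ (Real.sqrt η * L) ^ 2 := by
        rw [mul_pow, Real.sq_sqrt hη.le]
        nlinarith [sq_nonneg (N : ℝ)]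
      exact (sq_le_sq₀ hN0.le (by positivity)).1 h4
    have hFN : F N = (L : ℝ) / (2 * N) := by
      simp only [hF_def]
      rw [if_pos ⟨h1, hNR⟩]
    rw [hFN]
    have h5 : 2 * (N : ℝ) / L ≤ Real.sqrt (dispersion (latticeMomentum L q)) := by
      refine Real.le_sqrt_of_sq_le ?_
      calc (2 * (N : ℝ) / L) ^ 2 = 4 * (N : ℝ) ^ 2 / (L : ℝ) ^ 2 := by ring
        _ ≤ 8 * (N : ℝ) ^ 2 / (L : ℝ) ^ 2 := by gcongr; norm_num
        _ ≤ _ := h2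
    calc (Real.sqrt (dispersion (latticeMomentum L q)))⁻¹ ≤ (2 * (N : ℝ) / L)⁻¹ :=
          inv_anti₀ (div_pos (by linarith) hL) h5
      _ = (L : ℝ) / (2 * N) := by rw [inv_div]
  -- (2) radial summation over the whole torus against the sphere count `#{dist = r} ≤ 4(2r+1)`
  have hrad := sum_radial_le (d := 2) F hF0 (0 : TorusSite 2 L)
    (card_filter_torusDist_eq_le two_pos 0) (fun u => torusDist_lt u 0)
  -- (3) each shell `1 ≤ r ≤ Rn` contributes at most `6 L`, and there are at most `√η L` of them
  have hterm : ∀ r ∈ range L, ((2 * (2 * (2 * r + 1) ^ (2 - 1)) : ℕ) : ℝ) * F r ≤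
      if 1 ≤ r ∧ r ≤ Rn then 6 * (L : ℝ) else 0 := by
    intro r _
    simp only [hF_def]
    split_ifs with h
    · have hr : (1 : ℝ) ≤ r := by exact_mod_cast h.1
      rw [show ((2 * (2 * (2 * r + 1) ^ (2 - 1)) : ℕ) : ℝ) = 4 * (2 * r + 1) by push_cast; ring,
        mul_div_assoc', div_le_iff₀ (by linarith)]
      nlinarith [mul_le_mul_of_nonneg_left hr hL.le]
    · rw [mul_zero]
  have hcount : ((((range L).filter fun r => 1 ≤ r ∧ r ≤ Rn).card : ℕ) : ℝ) ≤ Real.sqrt η * L := by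
    have hsub : ((range L).filter fun r => 1 ≤ r ∧ r ≤ Rn) ⊆ Icc 1 Rn := fun r hr => by
      rw [mem_Icc]
      exact (mem_filter.1 hr).2
    calc ((((range L).filter fun r => 1 ≤ r ∧ r ≤ Rn).card : ℕ) : ℝ) ≤ ((Icc 1 Rn).card : ℝ) := by
          exact_mod_cast card_le_card hsub
      _ = Rn := by rw [Nat.card_Icc, Nat.add_sub_cancel]
      _ ≤ Real.sqrt η * L := hRn
  calc ∑ q ∈ ((univ : Finset (TorusSite 2 L)).erase 0).filter
          (fun q => dispersion (latticeMomentum L q) ≤ η),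
        (Real.sqrt (dispersion (latticeMomentum L q)))⁻¹
      ≤ ∑ q ∈ ((univ : Finset (TorusSite 2 L)).erase 0).filter
          (fun q => dispersion (latticeMomentum L q) ≤ η), F (torusDist q 0) := sum_le_sum hpt
    _ ≤ ∑ q : TorusSite 2 L, F (torusDist q 0) :=
        sum_le_sum_of_subset_of_nonneg (subset_univ _) fun q _ _ => hF0 _
    _ ≤ ∑ r ∈ range L, ((2 * (2 * (2 * r + 1) ^ (2 - 1)) : ℕ) : ℝ) * F r := hrad
    _ ≤ ∑ r ∈ range L, (if 1 ≤ r ∧ r ≤ Rn then 6 * (L : ℝ) else 0) := sum_le_sum hterm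
    _ = ((((range L).filter fun r => 1 ≤ r ∧ r ≤ Rn).card : ℕ) : ℝ) * (6 * L) := by
        rw [sum_ite, sum_const_zero, add_zero, sum_const, nsmul_eq_mul]
    _ ≤ Real.sqrt η * L * (6 * L) := mul_le_mul_of_nonneg_right hcount (by positivity)
    _ = 6 * Real.sqrt η * (L : ℝ) ^ 2 := by ring

end Summit.HubbardSuperconductivity.HubbardSuperconductivity.Theorems.XYOrderOpennessLargeSpin

end
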